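import Summits.AtomisticToContinuum.Crystallization.Theorems.FrustratedLawDichotomyAtlasReachSharing
import Summits.AtomisticToContinuum.Crystallization.Theorems.FrustratedLawDichotomyTransportPriceFinite

/-!
(SPLIT FOR THE 400-LINE CAP by the landing lane, hand-2 g50: this file = part A (§1–§3); part B = `…FrustratedLawDichotomySymSharing` (§4–§6) imports it; same namespace, all FQNs unchanged; + 2 one-line docstrings (`apply_singleton_zero`, `symW_ne_top`) for the gate's lint.docstring; DEDUP ED1: the node's local `preimage_sub_closedBall_zero` is the landed `…TransportPriceFinite.preimage_sub_closedBall` — imported and cited, copy deleted (gate dedup.landed).)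
# FrustratedLawDichotomy · crux `AperiodicFrustratedLawGap` (stmt-AtomisticToContinuum-27623) — THE SYMMETRIC SHARING LEDGER:
# floors and cap read on a CONVEX local average of the site energies (decomp-a2c, RESIDUAL lens-5 «finite/base range + asymptotic regime + bridge»,
# generation 121; answers hand-2's structural share #134 `…AtlasReachSharing`)

THE FINDING THIS FILE ANSWERS.  #134 books row floors and the K2 cap slot on `ballAvgEnergy r μ = Σ_{atoms y ∈ B̄_r(0)} (e(y) + c₀)/N_r(y) − c₀`
(`e(y) = rootEnergy (θ_y μ)`, `N_r(y) = #atoms of μ in B̄_r(y)`, `c₀ = (250/12)(10/7)⁶ ≈ 177.08`): the SENDER-normalised sharing of the SHIFTED energy.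
Pointwise this is NOT an average of site energies: `ballAvgEnergy r μ = Σ_y e(y)/N_r(y) + c₀ · (w_r(μ) − 1)` with `w_r(μ) := Σ_{y ∈ B̄_r(0)} 1/N_r(y)`, and
`w_r ≠ 1` as soon as the coordination `N_r` is not constant over the root's ball — so the functional carries LEVERAGE `c₀ ≈ 177` on second-shell
coordination fluctuations (one ball-neighbour with `N = 14` instead of `13` moves it by `177·(1/13 − 1/14) ≈ 0.97`, a hundred times the TCP energy scale).
(hand-1 g59 found the same identity independently — STATUS l.10173, fcc + one vacancy: `w − 1 = −7/156`, `ballAvgEnergy ≈ −8.6`; confirmed crit-1 r1938.)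
Desk table of this generation (pure python, HOME/decomp-a2c-lens-5/g121/num/{symcur,nashcheck,sharebias}.py, SYMCUR-g121.md): on the periodic,
everywhere-frustrated Lennard-Jones A15 lattice (Cr₃Si type, optimal lattice constant `1.7754`: shortest pair distance `0.888 ≥ 7/10` on the CN14 chains,
CN12–CN14 `0.9925`; BOTH site classes numerically NASH = global minimiser of the field of all other atoms) the CN12 root has `N_{1.1} = 13` among CN14
neighbours with `N_{1.1} = 15`, and `ballAvgEnergy 1.1 = e_hcp − 21.6` although every site energy there is `≥ e_hcp + 0.022`: #134's cap slot
`e⋆ − ballAvgEnergy ≤ D` would need `D ≥ 21.5` (reach `≈ 10⁻⁴`), and at the CN14 root the row-floor currency reads a spurious `e_hcp + 7.3`.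
BALANCING THE CONSTANT IS NOT THE CURE.  The un-shifted SHARE currency `Σ_{y ∈ B̄_r(0)} e(y)/N_r(y)` (#134 minus the `c₀` term; hand-1's (H9) balanced
ledger) still has weights summing to `w_r(μ) ≠ 1`, i.e. it equals a weighted mean PLUS `(w_r − 1)·ē` with `|ē| ≈ 0.6–0.7`: leverage ÷ 250, not removed, and
`w_r − 1 = O(1)` under RADIUS STRADDLING — A15 uniformly scaled to lattice constant `1.800` (nn `0.900`, mean site energy `e_hcp + 0.090`, both site classes
still numerically Nash) rooted at CN12, `r = 11/10`: the 8 CN14–CN14 contacts move to `1.1023 > r`, so `N_r = 13` at the root but `7` at each of its 12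
ball-neighbours, `w = 1/13 + 12/7 = 1.79`, and the share currency reads `e_hcp − 0.380` (cap `D ≥ 0.31` even with the tree's `e⋆ ≥ −0.7865`; reach `< 0.75 %`)
while the plain ball mean is `e_hcp + 0.09`; C15 (optimal, `r = 1.35`, 8a root: `N` 17 vs 13) reads `e_hcp + 0.019` in share currency vs `+0.135` plain.
(hand-2's desk proxy used PLAIN ball averages, for which none of this happens; the typed functionals are not the proxy.)  The same sender-normalised weights
sit in gen-3 `…TransportPriceLocal.ballSharing_transport`.

THE FIX (this file).  Share with the SYMMETRIC, doubly-stochastic, translation-equivariant, local kernel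
  `k(x,y) = 1/max(N_r(x), N_r(y))` for atoms `0 < |x − y| ≤ r`,   `k(x,x) = 1 − Σ_{y ≠ x} k(x,y) ≥ 1/N_r(x)`,
transporting `(e(x) + c₀)·k(x,y) ≥ 0` from `x` to `y`.  Symmetry makes in-weights and out-weights coincide, so `c₀` CANCELS POINTWISE and
  `rootEnergy μ + net = symAvgEnergy r μ = e(0)·(1 − Σ_{0<|y|≤r} W(y)) + Σ_{0<|y|≤r} W(y)·e(y)`,  `W(y) = 1/max(N_r(0), N_r(y))`, `Σ W ≤ (N_r(0)−1)/N_r(0)`,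
a TRUE CONVEX COMBINATION of the site energies in the root's closed `r`-ball (`symAvgEnergy_eq_finsum`, §5) — equal to the plain ball average wherever `N_r`
is constant on the ball (fcc, hcp: `N_{1.1} ≡ 13`), and ALWAYS between the smallest and the largest site energy in the ball (no leverage on the coordination
pattern: a straddling radius changes the weights, never the range).  Desk readings in this currency (same table): fcc `+1.2·10⁻⁴`, hcp `0`, bcc `+0.031`,
A15 `+0.085/+0.091` (scaled `1.800`: `+0.103/+0.086`), C15 `+0.110/+0.169` above `e_hcp` at `r = 1.1`; the straddling dilated fcc core of sharebias.py
`+0.235` (share currency `−0.281`, #134 `+190`) — the local averaged crystallization inequality holds with room on the whole TCP / straddling base family.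
* §1–§2  the kernel, typed: ball counts through the tree's truncated identity kernel (`…FiniteClusterGapPrelude.exists_kernel_eq_count_restrict`,
  `measurable_kernel_map_sub`) so that `(μ, w) ↦ N_r(w)` is jointly measurable; `symShare r H` jointly measurable (`measurable_symShare`).
* §3  out-flow `= e + c₀` exactly (`lintegral_symShare`), in-flow `= symAvgIn r μ` (`lintegral_symShare_shift`), hence ★ `transported_eq_symAvgEnergy` and the
  admissible NULL LEDGER `symShare_nullLedger` (#132 `net_nullLedger`, by name).
* §4  ★★ `coherentMassExclusion_of_symAvg` — THE REACH THEOREM IN SYMMETRIC CURRENCY (#132 `coherentMassExclusion_of_floorsL`, by name): row floors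
  `e⋆ + m_i ≤ symAvgEnergy r μ` at rooted `7/10`-hard-core Nash configurations of row `i` (margins `≥ m > 0`) and the cap `e⋆ − symAvgEnergy r μ ≤ D` ONLY at
  rooted hard-core Nash configurations outside every row give F(η) for `η ≤ reach m D`; ★ `offAtlasMass_ge_of_symAvg` (energy–mass inequality, (a)(b)(e) only);
  ★★ junction `aperiodicFrustratedLawGap_of_offAtlasMassGap_symAvg`: these ∧ A(η) ⟹ crux ((404) `aperiodicFrustratedLawGap_of_massSplit`, by name).
* §5  LEGIBILITY `symAvgEnergy_eq_finsum`: on `count|S` the functional is the finite sum displayed above (what a K-file / desk certificate evaluates);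
  ★ NO LEVERAGE `symAvgEnergy_ge_of_forall_ge` / `symAvgEnergy_le_of_forall_le`: a common SITEWISE floor (ceiling) of the `≤ N_r(0)` site energies of the ball
  is a floor (ceiling) of `symAvgEnergy` — sitewise K-file certificates discharge the symmetric-currency slots, and no coordination pattern can move the value
  outside `[min_ball e, max_ball e]` (the typed form of «balancing is not the cure, double stochasticity is»).
* §6  THE STRICT DOOR `aperiodicFrustratedLawGap_of_symGap`: floors on the rows and a STRICT gap `e⋆ + g ≤ symAvgEnergy r μ` (`g > 0`) off the rows make the
  complement a row, the cap vacuous, `reach = 1` and A(1) trivial — the crux with NO residual (pointwise STRONGER than the cap; UNDECIDED).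
NODE (lens reading).  finite/base range = the local `r`-ball functional and its row floors [ATTACKABLE·INSTRUMENTABLE, K-lane]; asymptotic regime = the cap
`SymAvgCap(r, D)` [UNDECIDED; INSTRUMENTABLE falsifier = the periodic TCP / straddling table above + hand-2's glass families re-read in this currency; the open
adversary of record is the far-field-density / jammed-shell family of hand-1 (462), whose NASH members are the K2 question] with A(reach(m,D))
[IDEA-NEEDED residual of record, UNCHANGED] and its `D < 0` limit the strict door [UNDECIDED, A-free]; bridge = symmetric mass transport [PROVED here].
HONEST LABELS: bookkeeping/junction; no numeric `D`, `m` or reach is claimed; A(η) untouched.  Plain `def`s only (a chosen kernel, four `ℝ≥0∞`/`ℝ`-valued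
functionals, one set); no instance / notation / option; imports TREE #134 (hence #132, (404), gen-3 `…TransportPriceSurplus/Local`, the Prelude) only; 0 sorry.
-/

noncomputable section

namespace Summit.AtomisticToContinuum.Crystallization.Theorems.FrustratedLawDichotomySymSharing

open MeasureTheory Metric Set Filter ProbabilityTheory
open scoped ENNReal BigOperators
open Literature.MathematicalPhysics.StatisticalMechanics Literature.Probability.Process
open Literature.Probability.Process.LocalConfig (finite_inter_of_separated)
open Summit.AtomisticToContinuum.Crystallization.Theorems.ChargedEnergyGapNegative (E3 eStar)
open Summit.AtomisticToContinuum.Crystallization.Theorems.FrustratedLawDichotomyFiniteClusterGap (ae_mem_of_sep exists_kernel_eq_count_restrict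
  measurable_kernel_map_sub lintegral_count_restrict_of_finite)
open Summit.AtomisticToContinuum.Crystallization.Theorems.FrustratedLawDichotomySignedLedger (net)
open Summit.AtomisticToContinuum.Crystallization.Theorems.FrustratedLawDichotomyTransportPriceFinite (preimage_sub_closedBall)
open Summit.AtomisticToContinuum.Crystallization.Theorems.FrustratedLawDichotomyTransportPriceLocal (rootEnergy_add_c0_nonneg rootEnergy_le_C0)
open Summit.AtomisticToContinuum.Crystallization.Theorems.FrustratedLawDichotomyTransportPriceSurplus (exists_measurable_rootEnergy_surrogate)
open Summit.AtomisticToContinuum.Crystallization.Theorems.FrustratedLawDichotomyAtlasReach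
  (reach NoAdmissibleMinimiserWith CoherentMassExclusion OffAtlasMassGap aperiodicFrustratedLawGap_of_massSplit)
open Summit.AtomisticToContinuum.Crystallization.Theorems.FrustratedLawDichotomyAtlasReachLedger
  (net_nullLedger coherentMassExclusion_of_floorsL offAtlasMass_ge_of_floorsL)

/-! ## §1. Jointly measurable ball counts (the tree's truncated identity kernel) -/

/-- The tree's truncated identity kernel at hard core `7/10` (Prelude `exists_kernel_eq_count_restrict`), chosen once: an s-finite kernel
`Measure E3 → Measure E3` that fixes `count|S` for every `7/10`-separated `S`. [on tree] -/
def symIdKernel : Kernel (Measure E3) E3 :=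
  Classical.choose (exists_kernel_eq_count_restrict (by norm_num : (0 : ℝ) < 7 / 10))

/-- the chosen kernel is s-finite and is the identity on `7/10`-separated counting measures. -/
theorem symIdKernel_spec : IsSFiniteKernel symIdKernel ∧ ∀ S : Set E3, (∀ x ∈ S, ∀ y ∈ S, x ≠ y → (7 / 10 : ℝ) ≤ dist x y) →
    symIdKernel ((Measure.count : Measure E3).restrict S) = (Measure.count : Measure E3).restrict S :=
  Classical.choose_spec (exists_kernel_eq_count_restrict (by norm_num : (0 : ℝ) < 7 / 10))

/-- on a rooted `7/10`-hard-core configuration the truncated identity kernel returns the configuration itself. -/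
theorem symIdKernel_apply {μ : Measure E3} (hμ : IsRootedHardCore (7 / 10) μ) : symIdKernel μ = μ := by
  obtain ⟨S, -, hsep, rfl⟩ := hμ
  exact symIdKernel_spec.2 S hsep

/-- `N_r(μ, w)`: the mass of the closed `r`-ball about `w`, read through the kernel (`= μ (B̄_r(w))` on rooted hard-core `μ`, `symBallCount_eq`). -/
def symBallCount (r : ℝ) (μ : Measure E3) (w : E3) : ℝ≥0∞ :=
  ((symIdKernel μ).map fun z : E3 => z - w) (closedBall (0 : E3) r)

/-- `(μ, w) ↦ N_r(w)` is jointly measurable (through the kernel). -/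
theorem measurable_symBallCount (r : ℝ) : Measurable (Function.uncurry (symBallCount r)) := by
  haveI : IsSFiniteKernel symIdKernel := symIdKernel_spec.1
  exact (Measure.measurable_coe (measurableSet_closedBall (x := (0 : E3)) (ε := r))).comp (measurable_kernel_map_sub symIdKernel)

/-- pulling the closed `r`-ball about `−y` back along `z ↦ z − y` gives the closed `r`-ball about `0`. -/
theorem preimage_sub_closedBall_neg (y : E3) (r : ℝ) : (fun z : E3 => z - y) ⁻¹' closedBall (-y) r = closedBall (0 : E3) r := by
  ext z
  simp [dist_eq_norm]

/-- on a rooted hard-core configuration the kernel ball count is the plain ball count `μ (B̄_r(w))`. -/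
theorem symBallCount_eq {r : ℝ} {μ : Measure E3} (hμ : IsRootedHardCore (7 / 10) μ) (w : E3) :
    symBallCount r μ w = μ (closedBall w r) := by
  unfold symBallCount
  rw [symIdKernel_apply hμ, Measure.map_apply (measurable_sub_const w) measurableSet_closedBall, preimage_sub_closedBall]

/-! ## §2. The symmetric sharing kernel -/

/-- the symmetric weight `1 / max(N_r(μ,0), N_r(μ,w))` (kernel-read, jointly measurable). -/
def symWeight (r : ℝ) (μ : Measure E3) (w : E3) : ℝ≥0∞ := (max (symBallCount r μ 0) (symBallCount r μ w))⁻¹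

/-- `(μ, w) ↦ 1/max(N_r(0), N_r(w))` is jointly measurable. -/
theorem measurable_symWeight (r : ℝ) : Measurable (Function.uncurry (symWeight r)) := by
  have h := measurable_symBallCount r
  have h0 : Measurable fun q : Measure E3 × E3 => symBallCount r q.1 0 := h.comp (measurable_fst.prodMk measurable_const)
  exact (h0.max h).inv

/-- the punctured closed ball `B̄_r(0) ∖ {0}`. -/
def symPBall (r : ℝ) : Set E3 := closedBall (0 : E3) r \ {0}

/-- the punctured closed ball is measurable. -/
theorem measurableSet_symPBall (r : ℝ) : MeasurableSet (symPBall r) := measurableSet_closedBall.diff (measurableSet_singleton 0)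

/-- the root is not in the punctured ball. -/
theorem zero_notMem_symPBall (r : ℝ) : (0 : E3) ∉ symPBall r := fun h => h.2 (mem_singleton _)

/-- the punctured ball is symmetric under `y ↦ −y`. -/
theorem neg_mem_symPBall_iff {r : ℝ} {y : E3} : -y ∈ symPBall r ↔ y ∈ symPBall r := by
  simp only [symPBall, Set.mem_sdiff, mem_closedBall, dist_zero_right, norm_neg, mem_singleton_iff, neg_eq_zero]

/-- the mass the root keeps: `1 − Σ_{0<|z|≤r} 1/max(N_r(0), N_r(z))` (kernel-read). -/
def symRootSlack (r : ℝ) (μ : Measure E3) : ℝ≥0∞ := 1 - ∫⁻ z, (symPBall r).indicator (symWeight r μ) z ∂(symIdKernel μ)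

/-- the root slack `1 − Σ k(0,·)` is measurable in the configuration. -/
theorem measurable_symRootSlack (r : ℝ) : Measurable (symRootSlack r) := by
  haveI : IsSFiniteKernel symIdKernel := symIdKernel_spec.1
  have hf : Measurable (Function.uncurry fun (μ : Measure E3) (z : E3) => (symPBall r).indicator (symWeight r μ) z) :=
    (measurable_symWeight r).indicator (measurable_snd (measurableSet_symPBall r))
  exact measurable_const.sub (hf.lintegral_kernel_prod_right (κ := symIdKernel))

/-- ★ THE SYMMETRIC SHARING TRANSPORT of a (surrogate, shifted) energy `H`: the root sends `H·/max(N_r(0),N_r(w))` to each atom `w` with `0 < |w| ≤ r`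
and keeps `H·(1 − Σ_w 1/max(N_r(0),N_r(w)))` for itself. [new: kernel] -/
def symShare (r : ℝ) (H : Measure E3 → ℝ) (μ : Measure E3) (w : E3) : ℝ≥0∞ :=
  ({(0 : E3)} : Set E3).indicator (fun _ => ENNReal.ofReal (H μ) * symRootSlack r μ) w +
    (symPBall r).indicator (fun w => ENNReal.ofReal (H μ) * symWeight r μ w) w

/-- the symmetric share is jointly measurable in (configuration, receiver) for a measurable surrogate `H`. -/
theorem measurable_symShare (r : ℝ) {H : Measure E3 → ℝ} (hH : Measurable H) : Measurable (Function.uncurry (symShare r H)) := by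
  have h1 : Measurable fun q : Measure E3 × E3 => ENNReal.ofReal (H q.1) * symRootSlack r q.1 :=
    ((ENNReal.measurable_ofReal.comp hH).mul (measurable_symRootSlack r)).comp measurable_fst
  have h2 : Measurable fun q : Measure E3 × E3 => ENNReal.ofReal (H q.1) * symWeight r q.1 q.2 :=
    ((ENNReal.measurable_ofReal.comp hH).comp measurable_fst).mul (measurable_symWeight r)
  exact (h1.indicator (measurable_snd (measurableSet_singleton 0))).add (h2.indicator (measurable_snd (measurableSet_symPBall r)))

/-- the symmetric weight READ ON THE CONFIGURATION: `W_μ(y) = 1/max(μ B̄_r(0), μ B̄_r(y))`. -/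
def symW (r : ℝ) (μ : Measure E3) (y : E3) : ℝ≥0∞ := (max (μ (closedBall (0 : E3) r)) (μ (closedBall y r)))⁻¹

/-- on a rooted hard-core configuration the kernel weight is the configuration weight `symW`. -/
theorem symWeight_eq {r : ℝ} {μ : Measure E3} (hμ : IsRootedHardCore (7 / 10) μ) : symWeight r μ = symW r μ := by
  funext z
  unfold symWeight symW
  rw [symBallCount_eq hμ, symBallCount_eq hμ]

/-- ★ THE SYMMETRIC BALL AVERAGE (in-flow form, `ℝ≥0∞`): `(e(0)+c₀)·(1 − Σ_{0<|y|≤r} W(y)) + Σ_{0<|y|≤r} (e(y)+c₀)·W(y)`. [new: functional] -/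
def symAvgIn (r : ℝ) (μ : Measure E3) : ℝ≥0∞ :=
  ENNReal.ofReal (rootEnergy lennardJones μ + 250 / 12 * (10 / 7) ^ 6) * (1 - ∫⁻ y in symPBall r, symW r μ y ∂μ) +
    ∫⁻ y in symPBall r, ENNReal.ofReal (rootEnergy lennardJones (μ.map fun z : E3 => z - y) + 250 / 12 * (10 / 7) ^ 6) * symW r μ y ∂μ

/-- ★ THE SYMMETRIC BALL-AVERAGED ROOT ENERGY `symAvgEnergy r μ := symAvgIn r μ − c₀` — a convex combination of the site energies `rootEnergy (θ_y μ)`,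
`y ∈ B̄_r(0)` an atom, with weights `W(y) = 1/max(N_r(0),N_r(y))` off the root (§5 `symAvgEnergy_eq_finsum`). [new: functional] -/
def symAvgEnergy (r : ℝ) (μ : Measure E3) : ℝ := (symAvgIn r μ).toReal - 250 / 12 * (10 / 7) ^ 6

/-! ## §3. Out-flow, in-flow, the transported identity, the null ledger -/

/-- the root is an atom of unit mass. -/
theorem apply_singleton_zero {μ : Measure E3} (hμ : IsRootedHardCore (7 / 10) μ) : μ {0} = 1 := by
  obtain ⟨S, h0S, -, rfl⟩ := hμ
  rw [Measure.restrict_apply (measurableSet_singleton 0), inter_eq_left.mpr (singleton_subset_iff.mpr h0S), Measure.count_singleton]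

/-- the root's closed `r`-ball has positive mass (it contains the root). -/
theorem closedBall_ne_zero {r : ℝ} (hr : 0 < r) {μ : Measure E3} (hμ : IsRootedHardCore (7 / 10) μ) : μ (closedBall (0 : E3) r) ≠ 0 := by
  obtain ⟨S, h0S, -, rfl⟩ := hμ
  rw [Measure.restrict_apply measurableSet_closedBall]
  exact Measure.count_ne_zero ⟨0, mem_closedBall_self hr.le, h0S⟩

/-- the root's closed `r`-ball has finite mass (hard core + compactness). -/
theorem closedBall_ne_top (r : ℝ) {μ : Measure E3} (hμ : IsRootedHardCore (7 / 10) μ) : μ (closedBall (0 : E3) r) ≠ ∞ := by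
  obtain ⟨S, -, hsep, rfl⟩ := hμ
  rw [Measure.restrict_apply measurableSet_closedBall,
    Measure.count_apply_finite _ (finite_inter_of_separated (by norm_num : (0 : ℝ) < 7 / 10) hsep (isCompact_closedBall (0 : E3) r))]
  exact ENNReal.natCast_ne_top _

/-- the weights off the root sum to at most `1` (indeed to `≤ (N−1)/N`). -/
theorem lintegral_symW_le_one {r : ℝ} (hr : 0 < r) {μ : Measure E3} (hμ : IsRootedHardCore (7 / 10) μ) :
    ∫⁻ y in symPBall r, symW r μ y ∂μ ≤ 1 := by
  rw [← lintegral_indicator (measurableSet_symPBall r)]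
  calc ∫⁻ y, (symPBall r).indicator (symW r μ) y ∂μ
      ≤ ∫⁻ y, (closedBall (0 : E3) r).indicator (fun _ => (μ (closedBall (0 : E3) r))⁻¹) y ∂μ := by
        refine lintegral_mono fun y => ?_
        by_cases hy : y ∈ symPBall r
        · rw [indicator_of_mem hy, indicator_of_mem hy.1]
          exact ENNReal.inv_le_inv.mpr (le_max_left _ _)
        · rw [indicator_of_notMem hy]
          exact bot_le
    _ = (μ (closedBall (0 : E3) r))⁻¹ * μ (closedBall (0 : E3) r) := lintegral_indicator_const measurableSet_closedBall _
    _ = 1 := ENNReal.inv_mul_cancel (closedBall_ne_zero hr hμ) (closedBall_ne_top r hμ)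

/-- the root slack read on the configuration: `1 − ∫_{0<|y|≤r} W dμ`. -/
theorem symRootSlack_eq {r : ℝ} {μ : Measure E3} (hμ : IsRootedHardCore (7 / 10) μ) :
    symRootSlack r μ = 1 - ∫⁻ y in symPBall r, symW r μ y ∂μ := by
  unfold symRootSlack
  rw [symIdKernel_apply hμ, symWeight_eq hμ, lintegral_indicator (measurableSet_symPBall r)]

/-- OUT-FLOW: the kernel is stochastic — the root sends exactly `H μ` in total. [new: bookkeeping] -/
theorem lintegral_symShare {r : ℝ} (hr : 0 < r) (H : Measure E3 → ℝ) {μ : Measure E3} (hμ : IsRootedHardCore (7 / 10) μ) :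
    ∫⁻ w, symShare r H μ w ∂μ = ENNReal.ofReal (H μ) := by
  have hslack : symRootSlack r μ + ∫⁻ y in symPBall r, symW r μ y ∂μ = 1 := by
    rw [symRootSlack_eq hμ]
    exact tsub_add_cancel_of_le (lintegral_symW_le_one hr hμ)
  have hm1 : Measurable fun w => ({(0 : E3)} : Set E3).indicator (fun _ => ENNReal.ofReal (H μ) * symRootSlack r μ) w :=
    measurable_const.indicator (measurableSet_singleton 0)
  unfold symShare
  rw [lintegral_add_left hm1, lintegral_indicator_const (measurableSet_singleton 0), apply_singleton_zero hμ, mul_one]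
  simp_rw [indicator_const_mul]
  rw [lintegral_const_mul' _ _ ENNReal.ofReal_ne_top, symWeight_eq hμ, lintegral_indicator (measurableSet_symPBall r), ← mul_add, hslack, mul_one]

/-- IN-FLOW: what the root receives is `symAvgIn r μ` (for the surrogate `H = rootEnergy + c₀` on rooted hard-core configurations). [new: bookkeeping] -/
theorem lintegral_symShare_shift {r : ℝ} {H : Measure E3 → ℝ}
    (hH : ∀ ν : Measure E3, IsRootedHardCore (7 / 10) ν → H ν = rootEnergy lennardJones ν - (-(250 / 12 * (10 / 7) ^ 6)))
    {μ : Measure E3} (hμ : IsRootedHardCore (7 / 10) μ) :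
    ∫⁻ y, symShare r H (μ.map fun z : E3 => z - y) (-y) ∂μ = symAvgIn r μ := by
  obtain ⟨S, h0S, hsep, hμS⟩ := id hμ
  have h7 : (0 : ℝ) < 7 / 10 := by norm_num
  have hae : ∀ᵐ y ∂μ, symShare r H (μ.map fun z : E3 => z - y) (-y) =
      ({(0 : E3)} : Set E3).indicator (fun _ => ENNReal.ofReal (rootEnergy lennardJones μ + 250 / 12 * (10 / 7) ^ 6) * symRootSlack r μ) y +
        (symPBall r).indicator
          (fun y => ENNReal.ofReal (rootEnergy lennardJones (μ.map fun z : E3 => z - y) + 250 / 12 * (10 / 7) ^ 6) * symW r μ y) y := by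
    have h1 : ∀ᵐ y ∂μ, y ∈ S := by
      rw [hμS]; exact ae_mem_of_sep h7 hsep
    filter_upwards [h1] with y hy
    have hy' : μ {y} ≠ 0 := by
      rw [hμS]; exact (count_restrict_singleton_ne_zero_iff S y).mpr hy
    have hθ : IsRootedHardCore (7 / 10) (μ.map fun z : E3 => z - y) := hμ.map_sub hy'
    by_cases hy0 : y = 0
    · subst hy0
      have hθ0 : (μ.map fun z : E3 => z - 0) = μ := by simp only [sub_zero, Measure.map_id']
      rw [neg_zero, hθ0]
      unfold symShare
      rw [indicator_of_mem (mem_singleton _), indicator_of_mem (mem_singleton _), indicator_of_notMem (zero_notMem_symPBall r),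
        indicator_of_notMem (zero_notMem_symPBall r), hH μ hμ, sub_neg_eq_add]
    · have hny : -y ∉ ({(0 : E3)} : Set E3) := fun h => hy0 (neg_eq_zero.mp h)
      have hy0' : y ∉ ({(0 : E3)} : Set E3) := hy0
      unfold symShare
      rw [indicator_of_notMem hny, indicator_of_notMem hy0', zero_add, zero_add]
      by_cases hyb : y ∈ symPBall r
      · rw [indicator_of_mem (neg_mem_symPBall_iff.mpr hyb), indicator_of_mem hyb, hH _ hθ, sub_neg_eq_add]
        congr 1
        unfold symWeight symW
        rw [symBallCount_eq hθ, symBallCount_eq hθ, Measure.map_apply (measurable_sub_const y) measurableSet_closedBall,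
          Measure.map_apply (measurable_sub_const y) measurableSet_closedBall, preimage_sub_closedBall, preimage_sub_closedBall_neg, max_comm]
      · rw [indicator_of_notMem (fun h => hyb (neg_mem_symPBall_iff.mp h)), indicator_of_notMem hyb]
  have hm1 : Measurable fun w => ({(0 : E3)} : Set E3).indicator
      (fun _ => ENNReal.ofReal (rootEnergy lennardJones μ + 250 / 12 * (10 / 7) ^ 6) * symRootSlack r μ) w :=
    measurable_const.indicator (measurableSet_singleton 0)
  rw [lintegral_congr_ae hae, lintegral_add_left hm1, lintegral_indicator_const (measurableSet_singleton 0), apply_singleton_zero hμ, mul_one,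
    lintegral_indicator (measurableSet_symPBall r), symRootSlack_eq hμ]
  rfl

/-- ★ THE IDENTITY: the transported root energy of the symmetric sharing ledger IS the symmetric ball average — `c₀` cancels pointwise. [new: bookkeeping] -/
theorem transported_eq_symAvgEnergy {r : ℝ} (hr : 0 < r) {H : Measure E3 → ℝ}
    (hH : ∀ ν : Measure E3, IsRootedHardCore (7 / 10) ν → H ν = rootEnergy lennardJones ν - (-(250 / 12 * (10 / 7) ^ 6)))
    {μ : Measure E3} (hμ : IsRootedHardCore (7 / 10) μ) :
    rootEnergy lennardJones μ + net (symShare r H) (fun _ _ => 0) μ = symAvgEnergy r μ := by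
  unfold net symAvgEnergy
  rw [lintegral_symShare_shift hH hμ, lintegral_symShare hr H hμ, hH μ hμ, sub_neg_eq_add, ENNReal.toReal_ofReal (rootEnergy_add_c0_nonneg hμ)]
  simp only [lintegral_zero, ENNReal.toReal_zero, sub_zero]
  ring

/-- The symmetric sharing transport of the shifted energy is an admissible NULL LEDGER (#132 `net_nullLedger`, by name): jointly measurable, out-flow
`≤ C₀ + c₀` on rooted `7/10`-hard-core configurations. [folklore: mass transport] -/
theorem symShare_nullLedger {r : ℝ} (hr : 0 < r) {H : Measure E3 → ℝ} (hHm : Measurable H)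
    (hH : ∀ ν : Measure E3, IsRootedHardCore (7 / 10) ν → H ν = rootEnergy lennardJones ν - (-(250 / 12 * (10 / 7) ^ 6))) :
    ∀ P : Measure (Measure E3), IsProbabilityMeasure P → (∀ᵐ μ ∂P, IsRootedHardCore (7 / 10) μ) → IsPointStationaryLaw P →
      Integrable (net (symShare r H) fun _ _ => 0) P ∧ ∫ μ, net (symShare r H) (fun _ _ => 0) μ ∂P ≤ 0 := by
  refine net_nullLedger (symShare r H) (fun _ _ => 0) (measurable_symShare r hHm) measurable_const
    (BF := ENNReal.ofReal (250 / 24 * (10 / 7) ^ 12 + 250 / 12 * (10 / 7) ^ 6)) (BG := 0) ENNReal.ofReal_ne_top ENNReal.zero_ne_top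
    (fun μ hμ => ?_) (fun μ _ => by simp)
  rw [lintegral_symShare hr H hμ, hH μ hμ, sub_neg_eq_add]
  exact ENNReal.ofReal_le_ofReal (by linarith [rootEnergy_le_C0 hμ])

end Summit.AtomisticToContinuum.Crystallization.Theorems.FrustratedLawDichotomySymSharing

end
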